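import Literature.MathematicalPhysics.QuantumFieldTheory.Balaban1983to89.B12Eq213Body268
import Literature.MathematicalPhysics.QuantumFieldTheory.Balaban1983to89.T4CauchySum

/-!
# `Balaban1983to89.B12Eq213CouplingDependence` — T. Bałaban, *Renormalization group approach to lattice gauge field
theories. I. Generation of effective actions in a small field approximation and a coupling constant renormalization in
four dimensions*, Commun. Math. Phys. **109** (1987) 249–301 [Balaban1987RG1], (2.13) p. 268 with p. 263 ll. 22–28,
p. 256 and p. 298: **how the new term `𝐄^{(k+1)}(g_k, U_{k+1}) = log ∫dμ_{C^{(k)}}(B) χ_k exp[𝐏^{(k)} + {…}]` of the body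
of record (`B12Eq213Body268.FluctData.newTerm`) depends on the last coupling `g_k` and on the old action `𝐄_k` (hence on
all preceding couplings) — the two-sided comparison principle of the (2.13) integral, kernel-checked on the body**

statement-level skeleton of published theorems with citation tags; proofs where landed; nothing here is a claim about
the Yang–Mills mass gap

PDF held: `paper:balaban1987-cmp109-rg-i-small-field` (journal page = PDF page + 248); p. 263 [PDF 15], p. 268 [PDF 20],
p. 298 [PDF 50] re-read this session from the text layer (`lit read`, pages 15–22, 40–53).

CITATION HEADER / WHAT IS REPRODUCED (cell `pub-ymgap`, HUMAN RULING D-0062 Track A, seat `pub-ymgap-dag-n22-b` = the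
FIRST-MISSING-ESTIMATE seat of DAG node N22 = spine estimate NE9 «joint Lipschitz dependence of the scale-j term on the
COUPLING HISTORY, with fading memory», statement of record `T4OutputRate.NE9 E W κ Λ ∧ T4OutputRate.FadingMemory C₉ ω Λ`;
a NEW LEAF over the lit-balaban r20 module `B12Eq213Body268` (p368968; (2.13) WITH BODY) and the cell-`pub-balaban` module
`T4CauchySum` (the comparison engine `abs_log_integral_sub_le`), nothing there modified).

THE PRINT.  p. 268 [PDF 20] (2.13): *«The integral in (2.12) defines the new term 𝐄^{(k+1)} in the inductive definition of
the action A_{k+1} by the formula 𝐄^{(k+1)}(g_k, U_{k+1}) = log ∫dμ_{C^{(k)}}(B) χ_k exp[𝐏^{(k)}(g_k, U_{k+1}, B) + {…}].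
(2.13) Let us remark that the expression under the exponential above vanishes at g_k = 0»*, the curly bracket being the
last line of (2.12), *«{𝐄_k(U_k(exp i[g_kCB − hD̃(g_kCB)]V^{(k)})) − 𝐄_k(U_k(V^{(k)}))}»* — so the new term depends on the
LAST coupling `g_k` explicitly (through `𝐏^{(k)}` and the argument of `𝐄_k`) and on the EARLIER couplings `g₀, …, g_{k−1}`
ONLY through the old action `𝐄_k` inside the curly bracket.  p. 256 [PDF 8]: *«The function 𝐄_k depends also on the
effective coupling constants g₀, …, g_{k−1}. It is a sum of contributions coming from the k successive integrations in the
k renormalization transformations.»*  p. 263 [PDF 15] ll. 22–28 (the inductive hypothesis the step must reproduce): *«We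
assume that the function 𝐄^{(j)}(X, g_{j−1}, U, J) is defined and analytic on the space U^c_j(X, α₀, α₁) … It is a
C^∞-function of g_{j−1} ∈ [0, γ], (or analytic), with a positive, absolute γ. There exists a constant E₀ such that
|𝐄^{(j)}(X, g_{j−1}, U, J)| ≤ E₀ exp(−κd_j(X)) (1.18)»*.  p. 298 [PDF 50]: *«We write β_j as explicitly dependent on g_{j−1}
although it depends also on all preceding coupling constants. The dependence on g_{j−1} is important and it determines
main properties of the renormalization group equations.»*  NOTHING QUANTITATIVE about either dependence is printed (cell
`pub-balaban` GAPS G-t4-U3-3; census `pub-balaban-gaps/ne/NE9.md` §2): no modulus in `g_k`, none in the history.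

WHAT THIS MODULE DOES (THEOREMS ONLY; no definition, no named fact; imports the two modules above and modifies nothing).
It proves, for the BODY `FluctData.newTerm D g U = log ∫ χ_U(B)·exp[𝐏(g,U,B) + {…}(g,U,B)] dμ_U(B)` of [I] (2.13) — an
ARBITRARY datum `D : FluctData X` (measures, small-field characteristic function `0 ≤ χ ≤ 1`, the two exponent pieces),
i.e. for every inhabitant including Bałaban's — the elementary COMPARISON PRINCIPLE that is the structural source of both
dependences, and its consequences:
* §1 (engine, raw form over any measure space; `private` helpers) `integral_mul_exp_mono`, `log_integral_mul_exp_mono` — the small-field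
  integral `∫ χ e^{F} dμ` and its logarithm are MONOTONE in the exponent `F` on the support of `χ`;
  `abs_log_integral_mul_exp_sub_le` — and 1-LIPSCHITZ in the sup-distance of the exponents ON THE SUPPORT OF `χ`:
  `|F′ − F| ≤ r` on `{χ ≠ 0}` ⇒ `|log ∫χe^{F′} − log ∫χe^{F}| ≤ r` (an instance of `T4CauchySum.abs_log_integral_sub_le`,
  `c = 0`); `log_integral_mul_exp_add_const` — translation-equivariance `F ↦ F + c`.
* §2 (the last coupling) for the body: `newTerm_mono_of_exponent_le`; **`abs_newTerm_sub_newTerm_le`** (`|𝐄^{(k+1)}(g′, U) −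
  𝐄^{(k+1)}(g, U)| ≤ r` whenever the exponents at `g′` and `g` differ by at most `r` on `supp χ_U`); the LIPSCHITZ MODULUS IN
  THE LAST COUPLING **`abs_newTerm_sub_newTerm_le_mul`** / `lipschitzOnWith_newTerm` (a `g`-Lipschitz constant `L` of the
  exponent on the small-field support, uniform on a coupling set `S`, IS a `g`-Lipschitz constant of the new term on `S` —
  the quantitative form of p. 263's clause that the body supports with no further input; the printed clause itself is
  C^∞ and qualitative); `abs_newTerm_sub_log_mass_le` (two-sided size of the new term against the logarithm of the
  `μ_U`-mass of the small-field event: `|𝐄^{(k+1)}(g, U) − log ∫χ_U dμ_U| ≤ sup_{supp χ_U}|exponent|`, the two-sided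
  companion of the B16 lineage's one-sided `newTerm_le_of_supBound`), and with the p. 268 remark *«vanishes at g_k = 0»*
  `abs_newTerm_sub_log_mass_le_mul_of_vanishes` (`≤ L·|g|`).
* §2b (the last coupling, first order) **`hasDerivAt_integral`**, **`hasDerivAt_newTerm`**, `abs_deriv_newTerm_le`: p. 263's
  clause AT FIRST ORDER as a theorem of the body — if the exponent has a `g`-derivative bounded by `L` on a coupling ball for
  every `B` in the support of `χ_U` (plus measurability ∕ integrability), then `g ↦ 𝐄^{(k+1)}(g, U)` is differentiable with
  derivative THE EXPECTATION OF `∂_g(𝐏^{(k)} + {…})` IN THE SMALL-FIELD INTERACTING MEASURE at `(g, U)` (dominated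
  differentiation under (2.13), then `log`), and `|∂_g 𝐄^{(k+1)}(g, U)| ≤ L`.
* §3 (the history) TWO HISTORIES = the same step datum with two curly brackets `{…}` and `{…}′` (the old actions `𝐄_k`,
  `𝐄′_k` generated by two coupling histories; print p. 256), written with Lean's structure update `{ D with Q := Q′ }` so that
  measures, `χ_k` and `𝐏^{(k)}` are literally shared: **`abs_newTerm_withQ_sub_newTerm_le`** (`|{…}′ − {…}| ≤ r` on
  `supp χ_U` ⇒ the two new terms differ by `≤ r`); `abs_bracketDiff_le` + **`abs_newTerm_sub_newTerm_le_of_oldActions`** (when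
  the curly bracket IS the printed difference `𝐄_k(τ(g,U,B)) − 𝐄_k(σ(U))` of ONE old action evaluated at two configurations,
  two old actions that are `s`-close on a configuration set containing those arguments give new terms that are `2s`-close);
  **`abs_newTerm_sub_newTerm_le_joint`** (both the last coupling and the history changed: `≤ L·|g′ − g| + r`) — the
  UN-LOCALISED form, read on the body, of the ONE per-step inequality `T4HistoryLipschitzRecursion.StepLipschitz` from which
  the tree derives `NE9` (there: localized terms, decay factor `e^{−κd_j(X)}`, old-term constants `a k j`).
* §4 (bookkeeping of the recursion, arithmetic) `historyModuli_of_uniformStep`: a scalar sequence with `s₀ = 0` and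
  `s_{k+1} ≤ c·s_k + L·|g_k − g′_k|` obeys `s_k ≤ Σ_{i<k} L·c^{k−1−i}·|g_i − g′_i|` — with §3 (`c = 1 + 2`: the old action is
  carried forward once and enters the curly bracket twice) this is the A-PRIORI history modulus of the total small-field
  action in the sup-currency: the SHAPE of `T4OutputRate.NE9` with moduli `L·3^{age}`, i.e. WITHOUT fading memory
  (`T4OutputRate.FadingMemory` needs a rate `< 1`; cf. `T4HistoryLipschitzRecursion.sticky_not_fadingMemory`,
  `T4OutputRate.historySum_const`).  HONEST READING: the entire located content of NE9 (cell census C1–C46, WALL-NE9-P1) is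
  the replacement of the sup-currency and the factor `3` by the localized decay currency of [II] §§1–2 and a contraction
  rate `ω′ < 1` — the one-step cluster representation W1 as an OBJECT; this module supplies only the body-level first link.

WHAT IS *NOT* HERE: higher `g_k`-derivatives ∕ C^∞ ∕ analyticity of the new term (p. 263's clause as printed beyond first
order; the tree's hypothesis shapes `B12BetaSmooth.ESmoothHyp ∕ ESmoothAt`, GAPS G-b12-2 (i)); the differentiability of
Bałaban's exponent `𝐏^{(k)} + {…}` in `g_k` itself (it needs (2.12)'s explicit `𝐏^{(k)}` and the U-analyticity (1.17) of the
old action composed with `U_k(exp i[g_kCB − hD̃(g_kCB)]V^{(k)})` — displayed here as the hypothesis `hdiff`); any localization `𝐄^{(k+1)} = Σ_X 𝐄^{(k+1)}(X)`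
([II] §2); any property of Bałaban's `𝐏^{(k)}`, `χ_k`, `C^{(k)}` (which inhabit `FluctData` nowhere in the tree yet — NODE 00);
the coupling-dependence of `χ_k` (the datum's `χ` is coupling-free, as typed by r20 after (2.9) p. 266).  Every theorem is
elementary real analysis ([folklore]) about the typed body; the `[cite: …]` tags locate the printed object and sentences.
HONEST FRAMING: count-neutral Track-A side module; NOT a discharge of node N22; one finite T⁴ programme at fixed ε, Bałaban
AS PRINTED with locators; nothing continuum ∕ ℝ⁴ ∕ OS ∕ mass-gap ∕ Clay.

v1.1 (same seat, APPEND-ONLY; §§1–4 byte-identical to v1 p409146 ✓ de7c67c6d7f5): §5 = §2b in the RIGHT CURRENCY for Bałaban's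
exponent — `hasDerivAt_integral_of_dominated` ∕ `hasDerivAt_newTerm_of_dominated` (differentiation under (2.13) with an ARBITRARY
`μ_U`-integrable domination of `χ_k e^{exponent}·∂_g(exponent)` along the small-field support, instead of a uniform constant) and
`abs_deriv_newTerm_le_tilted` (`|∂_g 𝐄^{(k+1)}(g, U)| ≤` the expectation, in the small-field interacting measure, of any majorant
`m(B)` of `|∂_g(𝐏^{(k)} + {…})|` — for Bałaban's cubic terms `m` is a quadratic form in `B`, [II] (2.20) p. 16; its Gaussian
control (2.15)–(2.25) is NOT done here).
-/

noncomputable section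

namespace Literature.MathematicalPhysics.QuantumFieldTheory.Balaban1983to89.B12Eq213CouplingDependence

open _root_.MeasureTheory
open scoped BigOperators
open Literature.MathematicalPhysics.QuantumFieldTheory.Balaban1983to89
open Literature.MathematicalPhysics.QuantumFieldTheory.Balaban1983to89.B12Eq213Body268 (FluctData)

/-! ## §1. The comparison engine: `log ∫ χ e^{F} dμ` is monotone and 1-Lipschitz in `F` on the support of `χ` -/

section Engine

variable {Ω : Type*} [MeasurableSpace Ω] {μ : Measure Ω}

/-- MONOTONICITY of the small-field integral in the exponent: `0 ≤ χ`, `F ≤ F′` on `{χ ≠ 0}` and integrability give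
`∫ χ e^{F} dμ ≤ ∫ χ e^{F′} dμ`. [folklore] -/
private theorem integral_mul_exp_mono {χ F F' : Ω → ℝ} (h0 : ∀ ω, 0 ≤ χ ω)
    (hF : Integrable (fun ω => χ ω * Real.exp (F ω)) μ) (hF' : Integrable (fun ω => χ ω * Real.exp (F' ω)) μ)
    (hle : ∀ ω, χ ω ≠ 0 → F ω ≤ F' ω) :
    ∫ ω, χ ω * Real.exp (F ω) ∂μ ≤ ∫ ω, χ ω * Real.exp (F' ω) ∂μ := by
  refine integral_mono hF hF' fun ω => ?_
  by_cases hχ : χ ω = 0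
  · simp [hχ]
  · exact mul_le_mul_of_nonneg_left (Real.exp_le_exp.2 (hle ω hχ)) (h0 ω)

/-- MONOTONICITY of `log ∫ χ e^{F} dμ` in the exponent `F` on the support of `χ` (positive integral at the smaller
exponent). [folklore] -/
private theorem log_integral_mul_exp_mono {χ F F' : Ω → ℝ} (h0 : ∀ ω, 0 ≤ χ ω)
    (hF : Integrable (fun ω => χ ω * Real.exp (F ω)) μ) (hF' : Integrable (fun ω => χ ω * Real.exp (F' ω)) μ)
    (hpos : 0 < ∫ ω, χ ω * Real.exp (F ω) ∂μ) (hle : ∀ ω, χ ω ≠ 0 → F ω ≤ F' ω) :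
    Real.log (∫ ω, χ ω * Real.exp (F ω) ∂μ) ≤ Real.log (∫ ω, χ ω * Real.exp (F' ω) ∂μ) :=
  Real.log_le_log hpos (integral_mul_exp_mono h0 hF hF' hle)

/-- **THE COMPARISON PRINCIPLE**: `log ∫ χ e^{F} dμ` is 1-LIPSCHITZ in the sup-distance of the exponents ON THE SUPPORT OF
`χ` — if `|F′ − F| ≤ r` wherever `χ ≠ 0` (both integrands integrable, the `F`-integral positive) then
`|log ∫ χ e^{F′} dμ − log ∫ χ e^{F} dμ| ≤ r`.  Instance `c = 0` of `T4CauchySum.abs_log_integral_sub_le`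
(`e^{−r}·χe^{F} ≤ χe^{F′} ≤ e^{r}·χe^{F}` pointwise). [folklore] -/
private theorem abs_log_integral_mul_exp_sub_le {χ F F' : Ω → ℝ} {r : ℝ} (h0 : ∀ ω, 0 ≤ χ ω)
    (hF : Integrable (fun ω => χ ω * Real.exp (F ω)) μ) (hF' : Integrable (fun ω => χ ω * Real.exp (F' ω)) μ)
    (hpos : 0 < ∫ ω, χ ω * Real.exp (F ω) ∂μ) (hr : ∀ ω, χ ω ≠ 0 → |F' ω - F ω| ≤ r) :
    |Real.log (∫ ω, χ ω * Real.exp (F' ω) ∂μ) - Real.log (∫ ω, χ ω * Real.exp (F ω) ∂μ)| ≤ r := by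
  have hlow : ∀ᵐ ω ∂μ, Real.exp (0 - r) * (χ ω * Real.exp (F ω)) ≤ χ ω * Real.exp (F' ω) := by
    refine Filter.Eventually.of_forall fun ω => ?_
    by_cases hχ : χ ω = 0
    · simp [hχ]
    · have h1 := (abs_le.1 (hr ω hχ)).1
      calc Real.exp (0 - r) * (χ ω * Real.exp (F ω)) = χ ω * Real.exp (0 - r + F ω) := by
            rw [Real.exp_add]; ring
        _ ≤ χ ω * Real.exp (F' ω) := mul_le_mul_of_nonneg_left (Real.exp_le_exp.2 (by linarith)) (h0 ω)
  have hupp : ∀ᵐ ω ∂μ, χ ω * Real.exp (F' ω) ≤ Real.exp (0 + r) * (χ ω * Real.exp (F ω)) := by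
    refine Filter.Eventually.of_forall fun ω => ?_
    by_cases hχ : χ ω = 0
    · simp [hχ]
    · have h2 := (abs_le.1 (hr ω hχ)).2
      calc χ ω * Real.exp (F' ω) ≤ χ ω * Real.exp (0 + r + F ω) :=
            mul_le_mul_of_nonneg_left (Real.exp_le_exp.2 (by linarith)) (h0 ω)
        _ = Real.exp (0 + r) * (χ ω * Real.exp (F ω)) := by rw [Real.exp_add]; ring
  have h := T4CauchySum.abs_log_integral_sub_le (c := 0) (r := r) hF hF' hpos hlow hupp
  simpa only [sub_zero] using h

/-- TRANSLATION: adding a constant `c` to the exponent multiplies the small-field integral by `e^{c}`. [folklore] -/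
private theorem integral_mul_exp_add_const {χ F : Ω → ℝ} (c : ℝ) :
    ∫ ω, χ ω * Real.exp (F ω + c) ∂μ = Real.exp c * ∫ ω, χ ω * Real.exp (F ω) ∂μ := by
  rw [← integral_const_mul]
  refine integral_congr_ae (Filter.Eventually.of_forall fun ω => ?_)
  simp only [Real.exp_add]
  ring

/-- TRANSLATION-EQUIVARIANCE of `log ∫ χ e^{F} dμ`: the exponent `F + c` gives the value `+ c` (positive integral). [folklore] -/
private theorem log_integral_mul_exp_add_const {χ F : Ω → ℝ} (c : ℝ) (hpos : 0 < ∫ ω, χ ω * Real.exp (F ω) ∂μ) :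
    Real.log (∫ ω, χ ω * Real.exp (F ω + c) ∂μ) = Real.log (∫ ω, χ ω * Real.exp (F ω) ∂μ) + c := by
  rw [integral_mul_exp_add_const, Real.log_mul (Real.exp_pos c).ne' hpos.ne', Real.log_exp, add_comm]

end Engine

/-! ## §2. The new term of (2.13) and the LAST coupling `g_k` -/

section LastCoupling

variable {X : Type*} (D : FluctData X)

/-- The new term `𝐄^{(k+1)}(g, U)` of (2.13) is MONOTONE in the exponent `𝐏^{(k)} + {…}` on the support of `χ_k`: if the
exponent at `(g′, U)` dominates the exponent at `(g, U)` wherever `χ_U ≠ 0`, then `𝐄^{(k+1)}(g, U) ≤ 𝐄^{(k+1)}(g′, U)`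
(integrable integrands, positive integral at `g`). [cite: Balaban1987RG1, (2.13) p.268] -/
theorem newTerm_mono_of_exponent_le {g g' : ℝ} {U : X}
    (hint : Integrable (D.integrand g U) (D.μ U)) (hint' : Integrable (D.integrand g' U) (D.μ U))
    (hpos : 0 < D.integral g U) (hle : ∀ B, D.χ U B ≠ 0 → D.exponent g U B ≤ D.exponent g' U B) :
    D.newTerm g U ≤ D.newTerm g' U :=
  log_integral_mul_exp_mono (μ := D.μ U) (χ := D.χ U) (F := D.exponent g U) (F' := D.exponent g' U)
    (D.χ_nonneg U) hint hint' hpos hle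

/-- **The new term is 1-Lipschitz in the exponent on the small-field support**: if the exponents of (2.13) at the
couplings `g′` and `g` (same configuration `U`) differ by at most `r` wherever `χ_U ≠ 0`, then
`|𝐄^{(k+1)}(g′, U) − 𝐄^{(k+1)}(g, U)| ≤ r`. [cite: Balaban1987RG1, (2.13) p.268] -/
theorem abs_newTerm_sub_newTerm_le {g g' : ℝ} {U : X} {r : ℝ}
    (hint : Integrable (D.integrand g U) (D.μ U)) (hint' : Integrable (D.integrand g' U) (D.μ U))
    (hpos : 0 < D.integral g U) (hr : ∀ B, D.χ U B ≠ 0 → |D.exponent g' U B - D.exponent g U B| ≤ r) :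
    |D.newTerm g' U - D.newTerm g U| ≤ r :=
  abs_log_integral_mul_exp_sub_le (μ := D.μ U) (χ := D.χ U) (F := D.exponent g U) (F' := D.exponent g' U)
    (D.χ_nonneg U) hint hint' hpos hr

/-- **LIPSCHITZ MODULUS IN THE LAST COUPLING** (the quantitative form, supported by the body alone, of p. 263's clause
*«It is a C^∞-function of g_{j−1} ∈ [0, γ]»*): a `g`-Lipschitz constant `L` of the exponent `𝐏^{(k)}(g, U, B) + {…}(g, U, B)`
valid for all `B` in the support of `χ_U` and all couplings in a set `S` IS a `g`-Lipschitz constant of `𝐄^{(k+1)}(·, U)` on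
`S` (integrable integrands and positive integrals on `S`).  Print states no modulus. [cite: Balaban1987RG1, (2.13) p.268 and p.263 (clause before (1.18))] -/
theorem abs_newTerm_sub_newTerm_le_mul {S : Set ℝ} {U : X} {L : ℝ}
    (hint : ∀ g ∈ S, Integrable (D.integrand g U) (D.μ U)) (hpos : ∀ g ∈ S, 0 < D.integral g U)
    (hL : ∀ B, D.χ U B ≠ 0 → ∀ g ∈ S, ∀ g' ∈ S, |D.exponent g' U B - D.exponent g U B| ≤ L * |g' - g|)
    {g g' : ℝ} (hg : g ∈ S) (hg' : g' ∈ S) :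
    |D.newTerm g' U - D.newTerm g U| ≤ L * |g' - g| :=
  abs_newTerm_sub_newTerm_le D (hint g hg) (hint g' hg') (hpos g hg) fun B hB => hL B hB g hg g' hg'

/-- The same as a `LipschitzOnWith` statement for `g ↦ 𝐄^{(k+1)}(g, U)` on `S` (constant `L.toNNReal`, `0 ≤ L`).
[cite: Balaban1987RG1, (2.13) p.268 and p.263 (clause before (1.18))] -/
theorem lipschitzOnWith_newTerm {S : Set ℝ} {U : X} {L : ℝ} (hL0 : 0 ≤ L)
    (hint : ∀ g ∈ S, Integrable (D.integrand g U) (D.μ U)) (hpos : ∀ g ∈ S, 0 < D.integral g U)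
    (hL : ∀ B, D.χ U B ≠ 0 → ∀ g ∈ S, ∀ g' ∈ S, |D.exponent g' U B - D.exponent g U B| ≤ L * |g' - g|) :
    LipschitzOnWith L.toNNReal (fun g => D.newTerm g U) S := by
  refine LipschitzOnWith.of_dist_le_mul fun g hg g' hg' => ?_
  rw [Real.dist_eq, Real.dist_eq, Real.coe_toNNReal L hL0]
  exact abs_newTerm_sub_newTerm_le_mul D hint hpos hL hg' hg

/-- **TWO-SIDED SIZE OF THE NEW TERM** against the logarithm of the `μ_U`-mass of the small-field event: if
`|𝐏^{(k)} + {…}| ≤ M` on the support of `χ_U` then `|𝐄^{(k+1)}(g, U) − log ∫ χ_U dμ_U| ≤ M` (the small-field event of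
positive mass, `χ_U` and the integrand integrable) — the two-sided companion of the one-sided `FluctData.newTerm_le_of_supBound`
of the B16 lineage. [cite: Balaban1987RG1, (2.13)–(2.14) p.268] -/
theorem abs_newTerm_sub_log_mass_le {g : ℝ} {U : X} {M : ℝ}
    (hint : Integrable (D.integrand g U) (D.μ U)) (hχ : Integrable (D.χ U) (D.μ U))
    (hmass : 0 < ∫ B, D.χ U B ∂(D.μ U)) (hM : ∀ B, D.χ U B ≠ 0 → |D.exponent g U B| ≤ M) :
    |D.newTerm g U - Real.log (∫ B, D.χ U B ∂(D.μ U))| ≤ M := by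
  have hF : Integrable (fun B => D.χ U B * Real.exp ((fun _ => (0 : ℝ)) B)) (D.μ U) := by
    simpa using hχ
  have hpos0 : 0 < ∫ B, D.χ U B * Real.exp ((fun _ => (0 : ℝ)) B) ∂(D.μ U) := by simpa using hmass
  have h := abs_log_integral_mul_exp_sub_le (μ := D.μ U) (χ := D.χ U) (F := fun _ => (0 : ℝ))
    (F' := D.exponent g U) (r := M) (D.χ_nonneg U) hF hint hpos0 (fun B hB => by simpa using hM B hB)
  have e : (∫ B, D.χ U B * Real.exp ((fun _ => (0 : ℝ)) B) ∂(D.μ U)) = ∫ B, D.χ U B ∂(D.μ U) := by simp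
  rw [e] at h
  exact h

/-- With the p. 268 remark *«the expression under the exponential above vanishes at g_k = 0»* and a `g`-Lipschitz bound of
the exponent on the small-field support between `0` and `g`, the new term is within `L·|g|` of `log ∫ χ_U dμ_U` — the body's
reading of «the new term is created by the coupling». [cite: Balaban1987RG1, (2.13)–(2.14) p.268] -/
theorem abs_newTerm_sub_log_mass_le_mul_of_vanishes {g : ℝ} {U : X} {L : ℝ}
    (hint : Integrable (D.integrand g U) (D.μ U)) (hχ : Integrable (D.χ U) (D.μ U))
    (hmass : 0 < ∫ B, D.χ U B ∂(D.μ U)) (h0 : ∀ B, D.exponent 0 U B = 0)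
    (hL : ∀ B, D.χ U B ≠ 0 → |D.exponent g U B - D.exponent 0 U B| ≤ L * |g - 0|) :
    |D.newTerm g U - Real.log (∫ B, D.χ U B ∂(D.μ U))| ≤ L * |g| :=
  abs_newTerm_sub_log_mass_le D hint hχ hmass fun B hB => by simpa [h0 B] using hL B hB


/-! ### §2b. Differentiability in the last coupling: the derivative of the new term is the tilted expectation of `∂_g(exponent)` -/

/-- **DIFFERENTIATION UNDER THE (2.13) INTEGRAL.**  If, at the configuration `U`, the exponent `g ↦ 𝐏^{(k)}(g, U, B) + {…}(g, U, B)`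
has a `g`-derivative `e′ g B` on a coupling ball `|g − g₀| < ε` for every `B` in the support of `χ_U`, bounded there by `L`,
the integrands are a.e.-strongly measurable on the ball and integrable at `g₀`, and `e′ g₀` is a.e.-strongly measurable, then
*«the integral above»* `g ↦ ∫ χ_U e^{𝐏 + {…}} dμ_U` is differentiable at `g₀` with derivative `∫ χ_U e^{𝐏 + {…}}·e′(g₀) dμ_U`
(dominated differentiation, dominating function `L·e^{Lε}·(χ_U e^{exponent(g₀)})`). [cite: Balaban1987RG1, (2.13) p.268 and p.263 (clause before (1.18))] -/
theorem hasDerivAt_integral {U : X} {g₀ ε L : ℝ} (e' : ℝ → D.𝓑 → ℝ) (hε : 0 < ε)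
    (hmeas : ∀ g ∈ Metric.ball g₀ ε, AEStronglyMeasurable (D.integrand g U) (D.μ U))
    (hint : Integrable (D.integrand g₀ U) (D.μ U)) (he' : AEStronglyMeasurable (e' g₀) (D.μ U))
    (hdiff : ∀ B, D.χ U B ≠ 0 → ∀ g ∈ Metric.ball g₀ ε, HasDerivAt (fun g => D.exponent g U B) (e' g B) g)
    (hL : ∀ B, D.χ U B ≠ 0 → ∀ g ∈ Metric.ball g₀ ε, |e' g B| ≤ L) :
    HasDerivAt (fun g => D.integral g U) (∫ B, D.integrand g₀ U B * e' g₀ B ∂(D.μ U)) g₀ := by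
  -- the exponent is `L`-Lipschitz on the ball along the support of `χ_U` (mean value inequality)
  have hlip : ∀ B, D.χ U B ≠ 0 → ∀ g ∈ Metric.ball g₀ ε,
      |D.exponent g U B - D.exponent g₀ U B| ≤ L * |g - g₀| := by
    intro B hB g hg
    have h := Convex.norm_image_sub_le_of_norm_hasDerivWithin_le (f := fun g => D.exponent g U B) (f' := fun g => e' g B)
      (s := Metric.ball g₀ ε) (fun x hx => (hdiff B hB x hx).hasDerivWithinAt)
      (fun x hx => by simpa [Real.norm_eq_abs] using hL B hB x hx) (convex_ball g₀ ε) (Metric.mem_ball_self hε) hg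
    simpa [Real.norm_eq_abs] using h
  have key := hasDerivAt_integral_of_dominated_loc_of_deriv_le (μ := D.μ U) (F := fun g B => D.integrand g U B)
    (F' := fun g B => D.integrand g U B * e' g B) (x₀ := g₀) (bound := fun B => L * Real.exp (L * ε) * D.integrand g₀ U B)
    (s := Metric.ball g₀ ε) (Metric.ball_mem_nhds g₀ hε) ?_ hint ?_ ?_ ?_ ?_
  · exact key.2
  · exact Filter.eventually_of_mem (Metric.ball_mem_nhds g₀ hε) hmeas
  · exact hint.aestronglyMeasurable.mul he'
  · refine Filter.Eventually.of_forall fun B g hg => ?_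
    by_cases hχ : D.χ U B = 0
    · simp [FluctData.integrand_apply, hχ]
    · have h1 : |e' g B| ≤ L := hL B hχ g hg
      have hLnn : 0 ≤ L := (abs_nonneg _).trans h1
      have h2 : D.exponent g U B ≤ D.exponent g₀ U B + L * ε := by
        have := (abs_le.1 (hlip B hχ g hg)).2
        have hgε : |g - g₀| ≤ ε := by
          have : dist g g₀ < ε := Metric.mem_ball.1 hg
          rw [Real.dist_eq] at this
          exact this.le
        nlinarith
      rw [Real.norm_eq_abs, abs_mul, abs_of_nonneg (D.integrand_nonneg g U B), FluctData.integrand_apply,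
        FluctData.integrand_apply]
      calc D.χ U B * Real.exp (D.exponent g U B) * |e' g B|
          ≤ D.χ U B * Real.exp (D.exponent g₀ U B + L * ε) * L :=
            mul_le_mul (mul_le_mul_of_nonneg_left (Real.exp_le_exp.2 h2) (D.χ_nonneg U B)) h1 (abs_nonneg _)
              (mul_nonneg (D.χ_nonneg U B) (Real.exp_nonneg _))
        _ = L * Real.exp (L * ε) * (D.χ U B * Real.exp (D.exponent g₀ U B)) := by rw [Real.exp_add]; ring
  · exact hint.const_mul _
  · refine Filter.Eventually.of_forall fun B g hg => ?_
    by_cases hχ : D.χ U B = 0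
    · have e0 : (fun g => D.integrand g U B) = fun _ => 0 := by
        funext g; simp [FluctData.integrand_apply, hχ]
      rw [e0]
      simpa [FluctData.integrand_apply, hχ] using hasDerivAt_const g (0 : ℝ)
    · have h := ((hdiff B hχ g hg).exp).const_mul (D.χ U B)
      simpa [FluctData.integrand_apply, mul_assoc] using h

/-- **THE NEW TERM IS C¹ IN THE LAST COUPLING, WITH THE TILTED-EXPECTATION FORMULA** — p. 263's clause *«It is a C^∞-function
of g_{j−1}»* at first order, as a theorem of the body modulo the differentiability of the exponent on the small-field support:
under the hypotheses of `hasDerivAt_integral` and a positive integral at `g₀`,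
`d/dg 𝐄^{(k+1)}(g, U)|_{g₀} = (∫ χ_U e^{𝐏+{…}} dμ_U)⁻¹ · ∫ χ_U e^{𝐏+{…}}·∂_g(𝐏+{…}) dμ_U` — the expectation of `∂_g(𝐏+{…})` in the
small-field interacting measure at `(g₀, U)`. [cite: Balaban1987RG1, (2.13) p.268 and p.263 (clause before (1.18))] -/
theorem hasDerivAt_newTerm {U : X} {g₀ ε L : ℝ} (e' : ℝ → D.𝓑 → ℝ) (hε : 0 < ε)
    (hmeas : ∀ g ∈ Metric.ball g₀ ε, AEStronglyMeasurable (D.integrand g U) (D.μ U))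
    (hint : Integrable (D.integrand g₀ U) (D.μ U)) (he' : AEStronglyMeasurable (e' g₀) (D.μ U))
    (hdiff : ∀ B, D.χ U B ≠ 0 → ∀ g ∈ Metric.ball g₀ ε, HasDerivAt (fun g => D.exponent g U B) (e' g B) g)
    (hL : ∀ B, D.χ U B ≠ 0 → ∀ g ∈ Metric.ball g₀ ε, |e' g B| ≤ L) (hpos : 0 < D.integral g₀ U) :
    HasDerivAt (fun g => D.newTerm g U)
      ((D.integral g₀ U)⁻¹ * ∫ B, D.integrand g₀ U B * e' g₀ B ∂(D.μ U)) g₀ := by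
  have h := (Real.hasDerivAt_log hpos.ne').comp g₀ (hasDerivAt_integral D e' hε hmeas hint he' hdiff hL)
  simpa [FluctData.newTerm, Function.comp_def] using h

/-- **THE LAST-COUPLING DERIVATIVE IS BOUNDED BY THE EXPONENT'S**: under the same hypotheses
`|d/dg 𝐄^{(k+1)}(g, U)|_{g₀}| ≤ L` (the tilted expectation of a function bounded by `L` on the small-field support).
[cite: Balaban1987RG1, (2.13) p.268 and p.263 (clause before (1.18))] -/
theorem abs_deriv_newTerm_le {U : X} {g₀ ε L : ℝ} (e' : ℝ → D.𝓑 → ℝ) (hε : 0 < ε)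
    (hint : Integrable (D.integrand g₀ U) (D.μ U))
    (hL : ∀ B, D.χ U B ≠ 0 → ∀ g ∈ Metric.ball g₀ ε, |e' g B| ≤ L) (hpos : 0 < D.integral g₀ U) :
    |(D.integral g₀ U)⁻¹ * ∫ B, D.integrand g₀ U B * e' g₀ B ∂(D.μ U)| ≤ L := by
  have hI : D.integral g₀ U = ∫ B, D.integrand g₀ U B ∂(D.μ U) := rfl
  have hnum : |∫ B, D.integrand g₀ U B * e' g₀ B ∂(D.μ U)| ≤ L * D.integral g₀ U := by
    rw [hI]
    have h1 : ‖∫ B, D.integrand g₀ U B * e' g₀ B ∂(D.μ U)‖ ≤ ∫ B, L * D.integrand g₀ U B ∂(D.μ U) := by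
      refine norm_integral_le_of_norm_le (hint.const_mul L) (Filter.Eventually.of_forall fun B => ?_)
      by_cases hχ : D.χ U B = 0
      · simp [FluctData.integrand_apply, hχ]
      · rw [Real.norm_eq_abs, abs_mul, abs_of_nonneg (D.integrand_nonneg g₀ U B), mul_comm]
        exact mul_le_mul_of_nonneg_right (hL B hχ g₀ (Metric.mem_ball_self hε)) (D.integrand_nonneg g₀ U B)
    rw [integral_const_mul] at h1
    simpa [Real.norm_eq_abs] using h1
  rw [abs_mul, abs_inv, abs_of_pos hpos]
  calc (D.integral g₀ U)⁻¹ * |∫ B, D.integrand g₀ U B * e' g₀ B ∂(D.μ U)|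
      ≤ (D.integral g₀ U)⁻¹ * (L * D.integral g₀ U) :=
        mul_le_mul_of_nonneg_left hnum (inv_nonneg.2 hpos.le)
    _ = L := by field_simp

end LastCoupling

/-! ## §3. The new term of (2.13) and the HISTORY: two old actions in the curly bracket -/

section History

variable {X : Type*} (D : FluctData X)

/-- **TWO HISTORIES, ONE STEP.**  The same step datum with two curly brackets `{…} = D.Q` and `{…}′ = Q′` (the old actions
generated by two coupling histories `g₀, …, g_{k−1}` and `g′₀, …, g′_{k−1}`, p. 256: *«The function 𝐄_k depends also on the
effective coupling constants g₀, …, g_{k−1}»*; measures, `χ_k`, `𝐏^{(k)}` literally shared via `{ D with Q := Q′ }`): if the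
two brackets differ by at most `r` on the support of `χ_U` at the coupling `g`, the two new terms differ by at most `r`.
[cite: Balaban1987RG1, (2.12)–(2.13) p.268 and §0 p.256] -/
theorem abs_newTerm_withQ_sub_newTerm_le (Q' : ℝ → X → D.𝓑 → ℝ) {g : ℝ} {U : X} {r : ℝ}
    (hint : Integrable (D.integrand g U) (D.μ U))
    (hint' : Integrable (FluctData.integrand { D with Q := Q' } g U) (D.μ U))
    (hpos : 0 < D.integral g U) (hr : ∀ B, D.χ U B ≠ 0 → |Q' g U B - D.Q g U B| ≤ r) :
    |FluctData.newTerm { D with Q := Q' } g U - D.newTerm g U| ≤ r :=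
  abs_log_integral_mul_exp_sub_le (μ := D.μ U) (χ := D.χ U) (F := D.exponent g U)
    (F' := FluctData.exponent { D with Q := Q' } g U) (D.χ_nonneg U) hint hint' hpos fun B hB => by
      simpa [FluctData.exponent_apply, add_sub_add_left_eq_sub] using hr B hB

/-- The curly bracket's STRUCTURE: it is the difference `𝐄_k(y₁) − 𝐄_k(y₀)` of ONE old action at two configurations
(print: `y₁ = U_k(exp i[g_kCB − hD̃(g_kCB)]V^{(k)})`, `y₀ = U_k(V^{(k)})`).  Two old actions `𝐄_k`, `𝐄′_k` that are `s`-close on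
a configuration set `S ∋ y₀, y₁` give brackets that are `2s`-close. [cite: Balaban1987RG1, (2.12) p.268 (last line)] -/
theorem abs_bracketDiff_le {Y : Type*} (Ek Ek' : Y → ℝ) (S : Set Y) {s : ℝ} (hS : ∀ y ∈ S, |Ek' y - Ek y| ≤ s)
    {y₁ y₀ : Y} (h₁ : y₁ ∈ S) (h₀ : y₀ ∈ S) :
    |(Ek' y₁ - Ek' y₀) - (Ek y₁ - Ek y₀)| ≤ 2 * s := by
  have e : (Ek' y₁ - Ek' y₀) - (Ek y₁ - Ek y₀) = (Ek' y₁ - Ek y₁) - (Ek' y₀ - Ek y₀) := by ring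
  rw [e]
  calc |(Ek' y₁ - Ek y₁) - (Ek' y₀ - Ek y₀)| ≤ |Ek' y₁ - Ek y₁| + |Ek' y₀ - Ek y₀| := abs_sub _ _
    _ ≤ s + s := add_le_add (hS y₁ h₁) (hS y₀ h₀)
    _ = 2 * s := by ring

/-- **HISTORY DEPENDENCE THROUGH THE OLD ACTION.**  When the datum's curly bracket IS the printed difference
`{…}(g, U, B) = 𝐄_k(τ(g, U, B)) − 𝐄_k(σ(U))` of an old action `𝐄_k : Y → ℝ` at the two configurations of (2.12), and a second
history's old action `𝐄′_k` is `s`-close to `𝐄_k` on a configuration set `S` containing `σ(U)` and every `τ(g, U, B)` with `B` in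
the support of `χ_U`, then the two new terms of (2.13) at `(g, U)` differ by at most `2s` (integrable integrands, positive
integral). [cite: Balaban1987RG1, (2.12)–(2.13) p.268 and §0 p.256] -/
theorem abs_newTerm_sub_newTerm_le_of_oldActions {Y : Type*} (τ : ℝ → X → D.𝓑 → Y) (σ : X → Y) (Ek Ek' : Y → ℝ)
    (S : Set Y) {s : ℝ} (hS : ∀ y ∈ S, |Ek' y - Ek y| ≤ s) {g : ℝ} {U : X}
    (hQ : ∀ B, D.Q g U B = Ek (τ g U B) - Ek (σ U))
    (hτ : ∀ B, D.χ U B ≠ 0 → τ g U B ∈ S) (hσ : σ U ∈ S)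
    (hint : Integrable (D.integrand g U) (D.μ U))
    (hint' : Integrable (FluctData.integrand { D with Q := fun g U B => Ek' (τ g U B) - Ek' (σ U) } g U) (D.μ U))
    (hpos : 0 < D.integral g U) :
    |FluctData.newTerm { D with Q := fun g U B => Ek' (τ g U B) - Ek' (σ U) } g U - D.newTerm g U| ≤ 2 * s :=
  abs_newTerm_withQ_sub_newTerm_le D (fun g U B => Ek' (τ g U B) - Ek' (σ U)) hint hint' hpos fun B hB => by
    rw [hQ B]
    exact abs_bracketDiff_le Ek Ek' S hS (hτ B hB) hσ

/-- **THE JOINT STEP INEQUALITY OF THE BODY** (last coupling AND history changed): with a `g`-Lipschitz constant `L` of the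
second history's exponent on the small-field support between `g` and `g′`, and brackets `r`-close at `g`,
`|𝐄′^{(k+1)}(g′, U) − 𝐄^{(k+1)}(g, U)| ≤ L·|g′ − g| + r` — the un-localised, body-level form of the per-step inequality
`T4HistoryLipschitzRecursion.StepLipschitz` (there with the decay factor `e^{−κd_j(X)}` and old-term constants `a k j`).
[cite: Balaban1987RG1, (2.12)–(2.13) p.268, §0 p.256 and §5 p.298] -/
theorem abs_newTerm_sub_newTerm_le_joint (Q' : ℝ → X → D.𝓑 → ℝ) {g g' : ℝ} {U : X} {L r : ℝ}
    (hint : Integrable (D.integrand g U) (D.μ U))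
    (hint'g : Integrable (FluctData.integrand { D with Q := Q' } g U) (D.μ U))
    (hint'g' : Integrable (FluctData.integrand { D with Q := Q' } g' U) (D.μ U))
    (hpos : 0 < D.integral g U) (hpos' : 0 < FluctData.integral { D with Q := Q' } g U)
    (hL : ∀ B, D.χ U B ≠ 0 →
      |FluctData.exponent { D with Q := Q' } g' U B - FluctData.exponent { D with Q := Q' } g U B| ≤ L * |g' - g|)
    (hr : ∀ B, D.χ U B ≠ 0 → |Q' g U B - D.Q g U B| ≤ r) :
    |FluctData.newTerm { D with Q := Q' } g' U - D.newTerm g U| ≤ L * |g' - g| + r := by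
  have h1 : |FluctData.newTerm { D with Q := Q' } g' U - FluctData.newTerm { D with Q := Q' } g U| ≤ L * |g' - g| :=
    abs_newTerm_sub_newTerm_le { D with Q := Q' } hint'g hint'g' hpos' hL
  have h2 : |FluctData.newTerm { D with Q := Q' } g U - D.newTerm g U| ≤ r :=
    abs_newTerm_withQ_sub_newTerm_le D Q' hint hint'g hpos hr
  calc |FluctData.newTerm { D with Q := Q' } g' U - D.newTerm g U|
      ≤ |FluctData.newTerm { D with Q := Q' } g' U - FluctData.newTerm { D with Q := Q' } g U|
        + |FluctData.newTerm { D with Q := Q' } g U - D.newTerm g U| := abs_sub_le _ _ _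
    _ ≤ L * |g' - g| + r := add_le_add h1 h2

end History

/-! ## §4. Bookkeeping of the recursion: the a-priori history moduli in the sup-currency (no fading) -/

section Recursion

/-- **A-PRIORI HISTORY MODULI.**  A scalar sequence with `s 0 = 0` (no term before the first step, p. 256 (0.23)) and the
uniform step inequality `s (k+1) ≤ c·s k + L·|g k − g′ k|` (`0 ≤ c`) satisfies
`s k ≤ Σ_{i<k} L·c^{k−1−i}·|g i − g′ i|`.  With §3 the total small-field action of the body obeys the step inequality in the
sup-currency with `c = 3` (the old action is carried to the new background once and enters the curly bracket of (2.12) twice)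
— the SHAPE of `T4OutputRate.NE9` with history moduli `L·3^{k−1−i}`: Lipschitz in the whole history, but with memory that
GROWS with the age.  Fading memory (`T4OutputRate.FadingMemory`, a rate `< 1`) is exactly what this a-priori bound does not
give and what the localized currency of [II] §§1–2 is for (tree: `T4HistoryLipschitzRecursion.ne9_and_fadingMemory_of_geometricStep`,
rate `ω + c` from a per-step CONTRACTION `ω` of old-term differences). [cite: Balaban1987RG1, §0 p.256 ((0.23)) and §5 p.298] -/
theorem historyModuli_of_uniformStep {s : ℕ → ℝ} {c L : ℝ} (hc : 0 ≤ c) (g g' : ℕ → ℝ)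
    (h0 : s 0 = 0) (hstep : ∀ k, s (k + 1) ≤ c * s k + L * |g k - g' k|) :
    ∀ k, s k ≤ ∑ i ∈ Finset.range k, L * c ^ (k - 1 - i) * |g i - g' i| := by
  intro k
  induction k with
  | zero => simp [h0]
  | succ k ih =>
    calc s (k + 1) ≤ c * s k + L * |g k - g' k| := hstep k
      _ ≤ c * (∑ i ∈ Finset.range k, L * c ^ (k - 1 - i) * |g i - g' i|) + L * |g k - g' k| := by
          have := mul_le_mul_of_nonneg_left ih hc
          linarith
      _ = ∑ i ∈ Finset.range (k + 1), L * c ^ (k + 1 - 1 - i) * |g i - g' i| := by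
          rw [Finset.sum_range_succ, Finset.mul_sum]
          congr 1
          · refine Finset.sum_congr rfl fun i hi => ?_
            rw [Finset.mem_range] at hi
            have e : k + 1 - 1 - i = (k - 1 - i) + 1 := by omega
            rw [e, pow_succ]
            ring
          · have e : k + 1 - 1 - k = 0 := by omega
            rw [e, pow_zero, mul_one]

end Recursion

/-! ## §5 (v1.1, APPEND-ONLY; §§1–4 byte-identical). Differentiation under (2.13) with a GENERAL integrable domination,
and the derivative bound as a TILTED EXPECTATION

Why.  §2b asks for a UNIFORM bound `|∂_g(𝐏^{(k)} + {…})| ≤ L` on the small-field support.  For Bałaban's exponent this is the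
wrong currency: after the scaling `B = g_kB′` (p. 267) the support of `χ_k` is `{|B′(b)| < ε₁}` in the ORIGINAL variable,
i.e. `|B| < ε₁g_k⁻¹` in the integration variable ([II] (1.34) p. 9), on which the cubic and higher terms `(1/g_k²)V(g_kB)`,
`(1/g_k²)G₃(g_kB)` of (2.12) and their `g_k`-derivatives are dominated by QUADRATIC FORMS in `B` with small constants
([II] (2.20) p. 16), not by constants.  The natural domination of `χ_k e^{exponent}·∂_g(exponent)` is therefore by an
arbitrary `μ_U`-integrable function, and the natural bound of `∂_g 𝐄^{(k+1)}` is the expectation of a majorant `m(B)` of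
`|∂_g(exponent)|` in the small-field interacting measure — to be estimated by the (2.15)–(2.22)-type Gaussian domination,
which is NOT done here. -/

section Dominated

variable {X : Type*} (D : FluctData X)

/-- **DIFFERENTIATION UNDER THE (2.13) INTEGRAL, GENERAL DOMINATION.**  As `hasDerivAt_integral`, with the uniform bound on
`∂_g(exponent)` replaced by an arbitrary `μ_U`-integrable domination `|χ_U e^{exponent(g)}·e′(g)| ≤ bound` on the coupling
ball along the support of `χ_U`. [cite: Balaban1987RG1, (2.13) p.268 and p.263 (clause before (1.18))] -/
theorem hasDerivAt_integral_of_dominated {U : X} {g₀ ε : ℝ} (e' : ℝ → D.𝓑 → ℝ) (bound : D.𝓑 → ℝ) (hε : 0 < ε)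
    (hmeas : ∀ g ∈ Metric.ball g₀ ε, AEStronglyMeasurable (D.integrand g U) (D.μ U))
    (hint : Integrable (D.integrand g₀ U) (D.μ U)) (he' : AEStronglyMeasurable (e' g₀) (D.μ U))
    (hdiff : ∀ B, D.χ U B ≠ 0 → ∀ g ∈ Metric.ball g₀ ε, HasDerivAt (fun g => D.exponent g U B) (e' g B) g)
    (hdom : ∀ B, D.χ U B ≠ 0 → ∀ g ∈ Metric.ball g₀ ε, |D.integrand g U B * e' g B| ≤ bound B)
    (hbound : Integrable bound (D.μ U)) :
    HasDerivAt (fun g => D.integral g U) (∫ B, D.integrand g₀ U B * e' g₀ B ∂(D.μ U)) g₀ := by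
  have key := hasDerivAt_integral_of_dominated_loc_of_deriv_le (μ := D.μ U) (F := fun g B => D.integrand g U B)
    (F' := fun g B => D.integrand g U B * e' g B) (x₀ := g₀) (bound := fun B => max (bound B) 0)
    (s := Metric.ball g₀ ε) (Metric.ball_mem_nhds g₀ hε) ?_ hint ?_ ?_ hbound.pos_part ?_
  · exact key.2
  · exact Filter.eventually_of_mem (Metric.ball_mem_nhds g₀ hε) hmeas
  · exact hint.aestronglyMeasurable.mul he'
  · -- domination by `bound⁺` (off the support the integrand vanishes, so only `0 ≤ bound⁺` is used there)
    refine Filter.Eventually.of_forall fun B g hg => ?_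
    by_cases hχ : D.χ U B = 0
    · simp [FluctData.integrand_apply, hχ]
    · rw [Real.norm_eq_abs]
      exact (hdom B hχ g hg).trans (le_max_left _ _)
  · refine Filter.Eventually.of_forall fun B g hg => ?_
    by_cases hχ : D.χ U B = 0
    · have e0 : (fun g => D.integrand g U B) = fun _ => 0 := by
        funext g; simp [FluctData.integrand_apply, hχ]
      rw [e0]
      simpa [FluctData.integrand_apply, hχ] using hasDerivAt_const g (0 : ℝ)
    · have h := ((hdiff B hχ g hg).exp).const_mul (D.χ U B)
      simpa [FluctData.integrand_apply, mul_assoc] using h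

/-- **C¹ IN THE LAST COUPLING WITH THE TILTED-EXPECTATION FORMULA, GENERAL DOMINATION**: under the hypotheses of
`hasDerivAt_integral_of_dominated` and a positive integral at `g₀`,
`d/dg 𝐄^{(k+1)}(g, U)|_{g₀} = (∫ χ_U e^{𝐏+{…}} dμ_U)⁻¹ · ∫ χ_U e^{𝐏+{…}}·∂_g(𝐏+{…}) dμ_U`. [cite: Balaban1987RG1, (2.13) p.268 and p.263 (clause before (1.18))] -/
theorem hasDerivAt_newTerm_of_dominated {U : X} {g₀ ε : ℝ} (e' : ℝ → D.𝓑 → ℝ) (bound : D.𝓑 → ℝ) (hε : 0 < ε)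
    (hmeas : ∀ g ∈ Metric.ball g₀ ε, AEStronglyMeasurable (D.integrand g U) (D.μ U))
    (hint : Integrable (D.integrand g₀ U) (D.μ U)) (he' : AEStronglyMeasurable (e' g₀) (D.μ U))
    (hdiff : ∀ B, D.χ U B ≠ 0 → ∀ g ∈ Metric.ball g₀ ε, HasDerivAt (fun g => D.exponent g U B) (e' g B) g)
    (hdom : ∀ B, D.χ U B ≠ 0 → ∀ g ∈ Metric.ball g₀ ε, |D.integrand g U B * e' g B| ≤ bound B)
    (hbound : Integrable bound (D.μ U)) (hpos : 0 < D.integral g₀ U) :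
    HasDerivAt (fun g => D.newTerm g U)
      ((D.integral g₀ U)⁻¹ * ∫ B, D.integrand g₀ U B * e' g₀ B ∂(D.μ U)) g₀ := by
  have h := (Real.hasDerivAt_log hpos.ne').comp g₀
    (hasDerivAt_integral_of_dominated D e' bound hε hmeas hint he' hdiff hdom hbound)
  simpa [FluctData.newTerm, Function.comp_def] using h

/-- **THE DERIVATIVE IS BOUNDED BY A TILTED EXPECTATION**: if `|∂_g(𝐏+{…})(g₀, U, B)| ≤ m(B)` on the support of `χ_U` with
`χ_U e^{exponent(g₀)}·m` integrable, then the value `(∫ χ_U e^{…})⁻¹·∫ χ_U e^{…}·e′(g₀)` of the last-coupling derivative is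
bounded in modulus by `(∫ χ_U e^{…} dμ_U)⁻¹ · ∫ χ_U e^{…}·m dμ_U` — the expectation of the majorant `m` in the small-field
interacting measure at `(g₀, U)` (for Bałaban's exponent `m` is a quadratic form in `B` with small constants, [II] (2.20)
p. 16; its tilted expectation is what the (2.15)–(2.22)-type Gaussian domination estimates — NOT done here).
[cite: Balaban1987RG1, (2.13) p.268 and p.263 (clause before (1.18))] -/
theorem abs_deriv_newTerm_le_tilted {U : X} {g₀ : ℝ} (e' : ℝ → D.𝓑 → ℝ) (m : D.𝓑 → ℝ)
    (hm : ∀ B, D.χ U B ≠ 0 → |e' g₀ B| ≤ m B)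
    (hintm : Integrable (fun B => D.integrand g₀ U B * m B) (D.μ U)) (hpos : 0 < D.integral g₀ U) :
    |(D.integral g₀ U)⁻¹ * ∫ B, D.integrand g₀ U B * e' g₀ B ∂(D.μ U)|
      ≤ (D.integral g₀ U)⁻¹ * ∫ B, D.integrand g₀ U B * m B ∂(D.μ U) := by
  have hnum : |∫ B, D.integrand g₀ U B * e' g₀ B ∂(D.μ U)| ≤ ∫ B, D.integrand g₀ U B * m B ∂(D.μ U) := by
    have h1 : ‖∫ B, D.integrand g₀ U B * e' g₀ B ∂(D.μ U)‖ ≤ ∫ B, D.integrand g₀ U B * m B ∂(D.μ U) := by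
      refine norm_integral_le_of_norm_le hintm (Filter.Eventually.of_forall fun B => ?_)
      by_cases hχ : D.χ U B = 0
      · simp [FluctData.integrand_apply, hχ]
      · rw [Real.norm_eq_abs, abs_mul, abs_of_nonneg (D.integrand_nonneg g₀ U B)]
        exact mul_le_mul_of_nonneg_left (hm B hχ) (D.integrand_nonneg g₀ U B)
    simpa [Real.norm_eq_abs] using h1
  rw [abs_mul, abs_inv, abs_of_pos hpos]
  exact mul_le_mul_of_nonneg_left hnum (inv_nonneg.2 hpos.le)

end Dominated

end Literature.MathematicalPhysics.QuantumFieldTheory.Balaban1983to89.B12Eq213CouplingDependence
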